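import Literature.Barriers.AtomisticToContinuum.HardDiskRuelleEstimate
import Literature.Analysis.FunctionSpaces.PoissonMeckeProofs
import HarnessLib

/-!
# Richthammer 2007, Lemma 3 for hard discs: discharge of `Richthammer2007_lemma3`

The named fact `Literature.Barriers.AtomisticToContinuum.HardDisk.Richthammer2007_lemma3`
(`HardDiskTranslationInvarianceSteps.lean`) is the Ruelle/Campbell bound
`∫ μ(dX) ∑≠_{x₁,…,x_m ∈ X} f(x₁,…,x_m) ≤ z^m ∫ dx₁⋯dx_m f(x₁,…,x_m)` for every Gibbs measure
`μ` of the planar hard-disc model at activity `z > 0` and every measurable `f ≥ 0`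
[Richthammer2007, §3.3 Lemma 3 (3.4), with the Ruelle bound `ξ = 1` of Lemma 4 (a)]. This file
proves it (`Richthammer2007_lemma3_holds`) along the printed proof [Richthammer2007, §4.2 (p. 9)]:

1. for `f` supported in `Λ_n^m`, the DLR equation (3.1) in `Λ_n` reduces the claim to a bound on
   the finite-volume Gibbs expectation `∫ γ_{Λ_n}(dX|X̄) ∑≠ f` uniformly in the boundary
   condition — here in the form of the inequality `IsGibbs.lintegral_le_lintegral_tsum_div`,
   `∫ F dμ ≤ ∫ μ(dX̄) (∑_k (z^k/k!) ∫_{Λ^k} 1[hc] F(X_Λ X̄_{Λᶜ}) dx) / Z_Λ(X̄)` for measurable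
   `F ≥ 0`, obtained from the set version of (3.1) (`IsGibbs`) by the monotone class argument
   (`Measurable.ennreal_induction`; only `≤` is needed, so no measurability in `X̄` enters);
2. the finite-volume bound is `tsum_lintegral_indicator_tsum_le` of `HardDiskRuelleEstimate.lean`
   (Poisson/Mecke computation and `ρ ≤ ξ^{#X} = 1`);
3. "letting `n → ∞` the assertion follows from the monotone limit theorem": the boxes `Λ_n`
   exhaust `ℝ²` (`iSup_indicator_pi_box`), sums over distinct points are measurable
   (`measurable_tsum_injective`, the measurability part of Campbell's theorem, from the tree's
   `exists_measurable_tsum_injective` with the s-finite counting kernel of `PointConfigKernel`),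
   and `lintegral_iSup`.

## References

* [Richthammer2007] T. Richthammer, *Translation-invariance of two-dimensional Gibbsian point
  processes*, Comm. Math. Phys. 274 (2007) 81–122, arXiv:0706.3637: §3.3 (3.1), Lemma 3 and
  (3.4) (p. 7), §3.4 Lemma 4 (a) (p. 8), §3.6 Lemma 6 (p. 8), §4.2 (p. 9).
-/

noncomputable section

open MeasureTheory Set Function
open scoped ENNReal

namespace Literature.Barriers.AtomisticToContinuum.HardDisk

open Literature.Analysis.FunctionSpaces

/-! ### Sums over distinct points: measurability and the monotone limit over boxes -/

/-- **Sums over tuples of distinct points are measurable**: for measurable `g ≥ 0` on `(ℝ²)^m`,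
`X ↦ ∑≠_{y₁,…,y_m ∈ X} g(y)` is measurable for the count σ-algebra (the measurability part of
Campbell's theorem, iterated; from the tree's `exists_measurable_tsum_injective` with the
s-finite counting kernel of `PointConfigKernel`). [cite: Richthammer2007, §3.6 Lemma 6 (p. 8)] -/
theorem measurable_tsum_injective {m : ℕ} {g : (Fin m → EuclideanSpace ℝ (Fin 2)) → ℝ≥0∞}
    (hg : Measurable g) :
    Measurable fun X : PointConfig (EuclideanSpace ℝ (Fin 2)) =>
      ∑' y : {y : Fin m → EuclideanSpace ℝ (Fin 2) // Injective y ∧ ∀ i, y i ∈ X}, g y.1 := by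
  obtain ⟨Φ, hΦm, hΦ⟩ := IsPoissonPointProcess.exists_measurable_tsum_injective
    (E := EuclideanSpace ℝ (Fin 2)) (PointConfig.countKernel (E := EuclideanSpace ℝ (Fin 2)))
    Set.univ (fun _ _ => rfl)
    (fun (c : PointConfig (EuclideanSpace ℝ (Fin 2))) _ => c.countable_carrier) m (α := Unit)
    (fun p : Unit × (Fin m → EuclideanSpace ℝ (Fin 2)) × PointConfig (EuclideanSpace ℝ (Fin 2)) =>
      g p.2.1) (hg.comp (measurable_fst.comp measurable_snd))
  have heq : (fun X : PointConfig (EuclideanSpace ℝ (Fin 2)) =>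
      ∑' y : {y : Fin m → EuclideanSpace ℝ (Fin 2) // Injective y ∧ ∀ i, y i ∈ X}, g y.1) =
        fun X => Φ ((), X) :=
    funext fun X => (hΦ () X (mem_univ X)).symm
  rw [heq]
  exact hΦm.comp (measurable_const.prodMk measurable_id)

/-- Monotone convergence for series: `∑_b ⨆_n g_n(b) = ⨆_n ∑_b g_n(b)` for a monotone sequence
`g_n ≥ 0`. [folklore] -/
theorem tsum_iSup_of_monotone {β : Type*} {g : ℕ → β → ℝ≥0∞} (hg : Monotone g) :
    ∑' b, ⨆ n, g n b = ⨆ n, ∑' b, g n b := by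
  rw [ENNReal.tsum_eq_iSup_sum]
  conv_rhs => arg 1; ext n; rw [ENNReal.tsum_eq_iSup_sum]
  rw [iSup_comm]
  refine iSup_congr fun s => ?_
  exact ENNReal.finsetSum_iSup_of_monotone fun b => fun i j h => hg h b

/-- The boxes `Λ_n^m` exhaust `(ℝ²)^m`: `⨆_n 1_{Λ_n^m} f = f`. [folklore] -/
theorem iSup_indicator_pi_box {m : ℕ} (f : (Fin m → EuclideanSpace ℝ (Fin 2)) → ℝ≥0∞)
    (y : Fin m → EuclideanSpace ℝ (Fin 2)) :
    ⨆ n : ℕ, (Set.pi univ fun _ => box n).indicator f y = f y := by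
  refine le_antisymm (iSup_le fun n => indicator_apply_le' (fun _ => le_rfl) fun _ => zero_le) ?_
  choose N hN using fun i => exists_mem_box (y i)
  refine le_iSup_of_le (Finset.univ.sup N) (le_of_eq ?_)
  rw [indicator_of_mem]
  exact fun i _ => box_mono (Nat.cast_le.2 (Finset.le_sup (Finset.mem_univ i))) (hN i)

/-- The cut-offs `1_{Λ_n^m} f` increase with `n`. [folklore] -/
theorem monotone_indicator_pi_box {m : ℕ} (f : (Fin m → EuclideanSpace ℝ (Fin 2)) → ℝ≥0∞) :
    Monotone fun n : ℕ => (Set.pi univ fun _ : Fin m => box n).indicator f := by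
  intro n n' h y
  exact indicator_le_indicator_of_subset (pi_mono fun _ _ => box_mono (Nat.cast_le.2 h))
    (fun _ => zero_le) y

/-! ### The DLR equation for functions, as an inequality -/

/-- **DLR (3.1) for nonnegative measurable functions, inequality form.** For a Gibbs measure `μ`
of the hard-disc model, a bounded measurable `Λ` and a measurable `F ≥ 0`,
`∫ F dμ ≤ ∫ μ(dX̄) (∑_k (z^k/k!) ∫_{Λ^k} 1[hard core] F(X_Λ X̄_{Λᶜ}) dx) / Z_Λ(X̄)`, i.e.
`∫ μ(dX) F(X) ≤ ∫ μ(dX̄) ∫ γ_Λ(dX|X̄) F(X)` with `γ_Λ(·|X̄)` written out (Richthammer 2007,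
(3.1), an equality there). From the set version `μ(A) = ∫ γ_Λ(A|X̄) μ(dX̄)` of `IsGibbs` by
induction over simple functions and monotone limits; the inequality needs no measurability of
`X̄ ↦ γ_Λ(·|X̄)`. [cite: Richthammer2007, §3.3 (3.1) (p. 7)] -/
theorem IsGibbs.lintegral_le_lintegral_tsum_div {z : ℝ}
    {μ : Measure (PointConfig (EuclideanSpace ℝ (Fin 2)))} (hμ : IsGibbs z μ)
    {Λ : Set (EuclideanSpace ℝ (Fin 2))} (hΛ : MeasurableSet Λ) (hΛb : Bornology.IsBounded Λ)
    {F : PointConfig (EuclideanSpace ℝ (Fin 2)) → ℝ≥0∞} (hF : Measurable F) :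
    ∫⁻ X, F X ∂μ ≤ ∫⁻ Y, (∑' k : ℕ, ENNReal.ofReal (z ^ k / k.factorial) *
        ∫⁻ x, {x | HardCoreIn Λ (superpose Λ x Y)}.indicator (fun x => F (superpose Λ x Y)) x
          ∂(Measure.pi fun _ : Fin k => volume.restrict Λ)) / weight z Λ Y univ ∂μ := by
  -- measurability of the finite-volume integrands, for a fixed boundary condition
  have hmeas : ∀ {G : PointConfig (EuclideanSpace ℝ (Fin 2)) → ℝ≥0∞}, Measurable G →
      ∀ (k : ℕ) (Y : PointConfig (EuclideanSpace ℝ (Fin 2))),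
        Measurable fun x : Fin k → EuclideanSpace ℝ (Fin 2) =>
          {x | HardCoreIn Λ (superpose Λ x Y)}.indicator (fun x => G (superpose Λ x Y)) x :=
    fun hG k Y => (hG.comp (measurable_superpose_left hΛ k Y)).indicator
      (measurableSet_hardCoreIn_superpose_left hΛ k Y)
  refine Measurable.ennreal_induction ?_ ?_ ?_ hF
  · -- multiples of indicators: the set version of the DLR equation
    intro c s hs
    rw [lintegral_indicator_const hs, hμ.2 Λ hΛ hΛb s hs]
    refine (lintegral_const_mul_le c _).trans (lintegral_mono fun Y => ?_)
    have hterm : ∀ (k : ℕ) (x : Fin k → EuclideanSpace ℝ (Fin 2)),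
        {x | HardCoreIn Λ (superpose Λ x Y)}.indicator
            (fun x => s.indicator (fun _ => c) (superpose Λ x Y)) x =
          c * (s ∩ {X | HardCoreIn Λ X}).indicator 1 (superpose Λ x Y) := by
      intro k x
      by_cases hx : HardCoreIn Λ (superpose Λ x Y)
      · rw [indicator_of_mem (show x ∈ {x | HardCoreIn Λ (superpose Λ x Y)} from hx)]
        by_cases hs' : superpose Λ x Y ∈ s
        · rw [indicator_of_mem hs', indicator_of_mem (mem_inter hs' hx), Pi.one_apply, mul_one]
        · rw [indicator_of_notMem hs', indicator_of_notMem fun h => hs' h.1, mul_zero]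
      · rw [indicator_of_notMem (show x ∉ {x | HardCoreIn Λ (superpose Λ x Y)} from hx),
          indicator_of_notMem fun h => hx h.2, mul_zero]
    have hnum : (∑' k : ℕ, ENNReal.ofReal (z ^ k / k.factorial) *
        ∫⁻ x, {x | HardCoreIn Λ (superpose Λ x Y)}.indicator
          (fun x => s.indicator (fun _ => c) (superpose Λ x Y)) x
          ∂(Measure.pi fun _ : Fin k => volume.restrict Λ)) = c * weight z Λ Y s := by
      unfold weight
      rw [← ENNReal.tsum_mul_left]
      refine tsum_congr fun k => ?_
      simp_rw [hterm k]
      rw [lintegral_const_mul c (measurable_weightIntegrand_left hΛ hs k Y), mul_left_comm]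
    rw [hnum, gibbsKernel, mul_div_assoc]
  · -- additivity
    intro f g _ hf hg hPf hPg
    have hadd : ∀ Y : PointConfig (EuclideanSpace ℝ (Fin 2)),
        (∑' k : ℕ, ENNReal.ofReal (z ^ k / k.factorial) *
          ∫⁻ x, {x | HardCoreIn Λ (superpose Λ x Y)}.indicator
            (fun x => (f + g) (superpose Λ x Y)) x ∂(Measure.pi fun _ : Fin k => volume.restrict Λ)) =
        (∑' k : ℕ, ENNReal.ofReal (z ^ k / k.factorial) *
          ∫⁻ x, {x | HardCoreIn Λ (superpose Λ x Y)}.indicator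
            (fun x => f (superpose Λ x Y)) x ∂(Measure.pi fun _ : Fin k => volume.restrict Λ)) +
        ∑' k : ℕ, ENNReal.ofReal (z ^ k / k.factorial) *
          ∫⁻ x, {x | HardCoreIn Λ (superpose Λ x Y)}.indicator
            (fun x => g (superpose Λ x Y)) x ∂(Measure.pi fun _ : Fin k => volume.restrict Λ) := by
      intro Y
      rw [← ENNReal.tsum_add]
      refine tsum_congr fun k => ?_
      rw [← mul_add, ← lintegral_add_left (hmeas hf k Y)]
      congr 1
      refine lintegral_congr fun x => ?_
      by_cases hx : x ∈ {x : Fin k → EuclideanSpace ℝ (Fin 2) | HardCoreIn Λ (superpose Λ x Y)}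
      · simp only [indicator_of_mem hx, Pi.add_apply]
      · simp only [indicator_of_notMem hx, add_zero]
    calc ∫⁻ X, (f + g) X ∂μ = ∫⁻ X, f X ∂μ + ∫⁻ X, g X ∂μ := lintegral_add_left hf g
      _ ≤ _ := add_le_add hPf hPg
      _ ≤ _ := le_lintegral_add _ _
      _ = _ := by
          refine lintegral_congr fun Y => ?_
          rw [hadd Y, ENNReal.add_div]
  · -- monotone limits
    intro f hf hmono hP
    rw [lintegral_iSup hf hmono]
    refine iSup_le fun n => (hP n).trans (lintegral_mono fun Y => ?_)
    refine ENNReal.div_le_div_right (ENNReal.tsum_le_tsum fun k => mul_le_mul' le_rfl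
      (lintegral_mono fun x => ?_)) _
    refine indicator_le_indicator ?_
    exact le_iSup (fun n => f n (superpose Λ x Y)) n

/-! ### Lemma 3 -/

/-- **Richthammer 2007, Lemma 3, for the planar hard-disc model (Ruelle bound `ξ = 1`).** For every
activity `z > 0`, every Gibbs measure `μ` of the hard-disc model and every measurable
`f : (ℝ²)^m → [0, ∞]`,
`∫ μ(dX) ∑≠_{x₁,…,x_m ∈ X} f(x₁,…,x_m) ≤ z^m ∫ dx₁⋯dx_m f(x₁,…,x_m)`.
Proof as printed (§4.2): for `f 1_{Λ_n^m}` the DLR equation in `Λ_n`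
(`IsGibbs.lintegral_le_lintegral_tsum_div`) and the Poisson computation with `ρ ≤ 1`
(`tsum_lintegral_indicator_tsum_le`) give the bound with `∫_{Λ_n^m} f ≤ ∫ f`; then `n → ∞` by
monotone convergence. This discharges the named fact `Richthammer2007_lemma3`.
[cite: Richthammer2007, §3.3 Lemma 3 (3.4) (p. 7), §3.4 Lemma 4 (a) (p. 8), §4.2 (p. 9)] -/
theorem Richthammer2007_lemma3_holds : Richthammer2007_lemma3 := by
  intro z hz μ hμ m f hf
  haveI : IsProbabilityMeasure μ := hμ.1
  -- the cut-offs `f 1_{Λ_n^m}` and the corresponding sums over distinct points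
  have hfn : ∀ n : ℕ, Measurable ((Set.pi univ fun _ : Fin m => box n).indicator f) := fun n =>
    hf.indicator (MeasurableSet.univ_pi fun _ => measurableSet_box n)
  have hFm : ∀ n : ℕ, Measurable fun X : PointConfig (EuclideanSpace ℝ (Fin 2)) =>
      ∑' y : {y : Fin m → EuclideanSpace ℝ (Fin 2) // Injective y ∧ ∀ i, y i ∈ X},
        (Set.pi univ fun _ : Fin m => box n).indicator f y.1 := fun n =>
    measurable_tsum_injective (hfn n)
  have hFmono : Monotone fun (n : ℕ) (X : PointConfig (EuclideanSpace ℝ (Fin 2))) =>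
      ∑' y : {y : Fin m → EuclideanSpace ℝ (Fin 2) // Injective y ∧ ∀ i, y i ∈ X},
        (Set.pi univ fun _ : Fin m => box n).indicator f y.1 := fun n n' h X =>
    ENNReal.tsum_le_tsum fun y => monotone_indicator_pi_box f h y.1
  have hsup : ∀ X : PointConfig (EuclideanSpace ℝ (Fin 2)),
      ∑' y : {y : Fin m → EuclideanSpace ℝ (Fin 2) // Injective y ∧ ∀ i, y i ∈ X}, f y.1 =
        ⨆ n : ℕ, ∑' y : {y : Fin m → EuclideanSpace ℝ (Fin 2) // Injective y ∧ ∀ i, y i ∈ X},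
          (Set.pi univ fun _ : Fin m => box n).indicator f y.1 := by
    intro X
    rw [← tsum_iSup_of_monotone]
    · exact tsum_congr fun y => (iSup_indicator_pi_box f y.1).symm
    · exact fun n n' h y => monotone_indicator_pi_box f h y.1
  -- the bound for each cut-off, uniformly in `n`
  have hbound : ∀ n : ℕ,
      ∫⁻ X, ∑' y : {y : Fin m → EuclideanSpace ℝ (Fin 2) // Injective y ∧ ∀ i, y i ∈ X},
          (Set.pi univ fun _ : Fin m => box n).indicator f y.1 ∂μ ≤
        ENNReal.ofReal z ^ m *
          ∫⁻ x, f x ∂(Measure.pi fun _ : Fin m => (volume : Measure (EuclideanSpace ℝ (Fin 2)))) := by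
    intro n
    have hΛ : MeasurableSet (box (n : ℝ)) := measurableSet_box n
    have hπ : (Measure.pi fun _ : Fin m => (volume : Measure (EuclideanSpace ℝ (Fin 2))).restrict
        (box (n : ℝ))) ≤ Measure.pi fun _ : Fin m => (volume : Measure (EuclideanSpace ℝ (Fin 2))) := by
      rw [← Measure.restrict_pi_pi]
      exact Measure.restrict_le_self
    refine (hμ.lintegral_le_lintegral_tsum_div hΛ (isBounded_box n) (hFm n)).trans ?_
    refine (lintegral_mono fun Y => ?_).trans (le_of_eq (by rw [lintegral_const, measure_univ,
      mul_one]))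
    refine ENNReal.div_le_of_le_mul ?_
    refine (tsum_lintegral_indicator_tsum_le hz.le hΛ Y hf).trans ?_
    exact mul_le_mul' (mul_le_mul' le_rfl (lintegral_mono' hπ le_rfl)) le_rfl
  -- monotone convergence
  calc ∫⁻ X, ∑' y : {y : Fin m → EuclideanSpace ℝ (Fin 2) // Injective y ∧ ∀ i, y i ∈ X}, f y.1 ∂μ
      = ∫⁻ X, ⨆ n : ℕ, ∑' y : {y : Fin m → EuclideanSpace ℝ (Fin 2) // Injective y ∧ ∀ i, y i ∈ X},
          (Set.pi univ fun _ : Fin m => box n).indicator f y.1 ∂μ :=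
        lintegral_congr fun X => hsup X
    _ = ⨆ n : ℕ, ∫⁻ X, ∑' y : {y : Fin m → EuclideanSpace ℝ (Fin 2) // Injective y ∧ ∀ i, y i ∈ X},
          (Set.pi univ fun _ : Fin m => box n).indicator f y.1 ∂μ :=
        lintegral_iSup hFm hFmono
    _ ≤ ENNReal.ofReal z ^ m *
          ∫⁻ x, f x ∂(Measure.pi fun _ : Fin m => (volume : Measure (EuclideanSpace ℝ (Fin 2)))) :=
        iSup_le hbound

end Literature.Barriers.AtomisticToContinuum.HardDisk

end
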